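import Literature.Analysis.PDE.SobolevPairing
import Literature.Analysis.PDE.Transfer
import HarnessLib

/-!
# The localised quasilinear operator on the Sobolev tuple spaces (abstract chart data)

Operator layer of the energy-method programme for short-time existence of quasilinear strictly
parabolic second-order systems on a closed manifold (hypothesis `hQL` of
`Literature.Geometry.Riemannian.ricciFlow_shortTime_existence_of_quasilinear`; Hamilton 1982,
§5; Taylor, *PDE III*, Ch. 15, §7). A closed manifold covered by `N` charts, with localisation
weights `α_k`, transition maps `τ_{kj}` and reconstruction multipliers `m_{kj}`, and a
quasilinear operator `P u = a(y, u, Du) ∂²u + f(y, u, Du)` written in each chart, is abstracted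
into **chart data** (`ChartData`): smooth compactly supported cut-offs `α_k`, transfer data
`T k j = (Ω_{kj}, τ_{kj}, m_{kj})` (`Transfer.lean`), and coefficient maps
`a_k = δ + b_k`, `f_k` on `ℝⁿ × (W × Wⁿ)` (position × first-order jet), smooth, `b_k, f_k`
vanishing for positions outside a fixed ball, `a_k` symmetric and uniformly elliptic. On the
Sobolev tuple spaces `𝐇_s` (`SobolevTupleSpace.lean`) this file defines, through the point
evaluations of `HsEval.lean`,

* `ghat k U` — the chart-`k` reconstruction `Σ_j m_{kj} · (rep_j U) ∘ τ_{kj}` and its formal first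
  derivatives `dghat k U i`, packaged as the first-order jet `jet1 k U : ℝⁿ → W × Wⁿ`; on smooth
  jets these are the classical objects (`ghat_jetH`, `dghat_jetH`), and they are continuous
  (`continuous_ghat`, `continuous_dghat`, `continuous_jet1`);
* `Fop k U` — the compactly supported part of the **diagonal localised operator**
  `𝒜̃_k(U) = Δ U_k + Σ b_k^{ii'}(y, j¹ĝ_k) ∂_{ii'} U_k + ℓ_k(y, j¹ĝ_k)`, where the lower-order
  correction `ell k U = ℓ_k = -Σ a^{ii'}(∂ᵢα_k ∂_{i'}ĝ + ∂_{i'}α_k ∂ᵢĝ + ∂_{ii'}α_k ĝ) + α_k f_k`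
  is chosen so that on a localised tuple `U = (α_k û_k)_k` with `ĝ_k = û_k` one gets exactly
  `𝒜̃_k(U) = α_k (a_k ∂²û_k + f_k)` by the Leibniz rule, i.e. the localisation of `P u`, while
  the principal part acts DIAGONALLY on the components — the structural point that makes
  Gårding's inequality available on the full tuple space; this file proves the support and
  continuity properties of `ell` and `Fop` (`ell_eq_zero`, `Fop_eq_zero`, `tsupport_Fop_subset`,
  `hasCompactSupport_Fop`, `continuous_ell`, `continuous_Fop`).

The Laplacian part `lapM`, the duality form `chartForm` required by Kato–Lai's Theorem A, its
weak sequential continuity, Gårding's inequality and the identity `Fop = FopR ∘ rep` with the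
classical operator on `C²` tuples are the subject of the FOLLOWING files of the layer
(`ChartForm.lean`, `Garding.lean`, `FluxR.lean`); they are not in this file.

Everything is proved; no named fact and no `sorry` is introduced.

## References

* M. E. Taylor, *Partial differential equations III*, 2nd ed., Springer 2011, Ch. 15, §7
  (localisation of quasilinear parabolic systems, Galerkin method). [TaylorPDEIII2011]
* T. Kato, C. Y. Lai, Nonlinear evolution equations and the Euler flow, J. Funct. Anal. 56
  (1984) 15–28, §3, Thm. A. [KatoLai1984]
* R. S. Hamilton, Three-manifolds with positive Ricci curvature, J. Differential Geom. 17 (1982),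
  §5. [Hamilton1982]
-/

noncomputable section

open MeasureTheory Set Function Filter Metric
open scoped ContDiff Topology RealInnerProductSpace ENNReal NNReal

namespace Literature.Analysis.PDE

open Literature.Analysis.FunctionSpaces

variable {ι : Type*} [Fintype ι] [DecidableEq ι]
variable {W : Type*} [NormedAddCommGroup W] [InnerProductSpace ℝ W] [CompleteSpace W]

/-! ### Chart data -/

/-- **Chart data** for the localised quasilinear operator: `N` charts; for each chart a smooth
compactly supported localisation weight `α k`; for each ordered pair of charts transfer data
`T k j` (transition map and reconstruction multiplier); coefficient maps on position × first jet,
`a k z = δ + b k z` (scalar symmetric matrix) and `f k z`, smooth, with `b k (y, ·) = 0` and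
`f k (y, ·) = 0` for `y` outside the ball of radius `R`, and the uniform ellipticity
`λ |ξ|² ≤ Σ a^{ii'} ξᵢ ξ_{i'}`; all supports inside the ball of radius `R`.
[cite: TaylorPDEIII2011, Ch. 15, §7] -/
structure ChartData (ι : Type*) [Fintype ι] [DecidableEq ι] (W : Type*) [NormedAddCommGroup W]
    [InnerProductSpace ℝ W] (N : ℕ) where
  /-- localisation weights -/
  α : Fin N → EuclideanSpace ℝ ι → ℝ
  /-- transfer data between charts -/
  T : Fin N → Fin N → TransferData ι
  /-- the non-constant part of the principal coefficients, `a = δ + b` -/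
  b : Fin N → EuclideanSpace ℝ ι × (W × (ι → W)) → ι → ι → ℝ
  /-- the lower-order coefficient -/
  f : Fin N → EuclideanSpace ℝ ι × (W × (ι → W)) → W
  /-- a radius bounding all supports -/
  R : ℝ
  /-- the ellipticity constant -/
  lam : ℝ
  contDiff_α : ∀ k, ContDiff ℝ ∞ (α k)
  tsupport_α : ∀ k, tsupport (α k) ⊆ ball 0 R
  contDiff_b : ∀ k, ContDiff ℝ ∞ (b k)
  contDiff_f : ∀ k, ContDiff ℝ ∞ (f k)
  b_eq_zero : ∀ k y j, R ≤ ‖y‖ → b k (y, j) = 0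
  f_eq_zero : ∀ k y j, R ≤ ‖y‖ → f k (y, j) = 0
  b_symm : ∀ k z i i', b k z i i' = b k z i' i
  R_pos : 0 < R
  lam_pos : 0 < lam
  elliptic : ∀ k z (ξ : ι → ℝ),
    lam * ∑ i, ξ i ^ 2 ≤ ∑ i, ξ i ^ 2 + ∑ i, ∑ i', b k z i i' * ξ i * ξ i'
  tsupport_m : ∀ k j, tsupport (T k j).m ⊆ ball 0 R
  image_τ : ∀ k j, (T k j).τ '' tsupport (T k j).m ⊆ ball 0 R

namespace ChartData

variable {N : ℕ} (𝒟 : ChartData ι W N)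

/-- The full principal coefficient `a = δ + b`. [cite: TaylorPDEIII2011, Ch. 15, §7] -/
def a (k : Fin N) (z : EuclideanSpace ℝ ι × (W × (ι → W))) (i i' : ι) : ℝ :=
  (if i = i' then 1 else 0) + 𝒟.b k z i i'

omit [CompleteSpace W] in
/-- `a` is symmetric. [folklore] -/
theorem a_symm (k : Fin N) (z : EuclideanSpace ℝ ι × (W × (ι → W))) (i i' : ι) :
    𝒟.a k z i i' = 𝒟.a k z i' i := by
  unfold a
  rw [𝒟.b_symm]
  by_cases h : i = i'
  · subst h; rfl
  · rw [if_neg h, if_neg (Ne.symm h)]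

omit [CompleteSpace W] in
/-- Uniform ellipticity of `a`: `λ |ξ|² ≤ Σ a^{ii'} ξᵢ ξ_{i'}`. [cite: TaylorPDEIII2011, Ch. 15, §7] -/
theorem a_elliptic (k : Fin N) (z : EuclideanSpace ℝ ι × (W × (ι → W))) (ξ : ι → ℝ) :
    𝒟.lam * ∑ i, ξ i ^ 2 ≤ ∑ i, ∑ i', 𝒟.a k z i i' * ξ i * ξ i' := by
  have h := 𝒟.elliptic k z ξ
  have hsum : ∑ i, ∑ i', 𝒟.a k z i i' * ξ i * ξ i' =
      ∑ i, ξ i ^ 2 + ∑ i, ∑ i', 𝒟.b k z i i' * ξ i * ξ i' := by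
    simp only [a, add_mul, Finset.sum_add_distrib]
    congr 1
    refine Finset.sum_congr rfl fun i _ => ?_
    rw [Finset.sum_eq_single i]
    · simp [sq]
    · intro i' _ hi'; simp [Ne.symm hi']
    · intro hi; exact absurd (Finset.mem_univ i) hi
  rw [hsum]; exact h

omit [CompleteSpace W] in
/-- Outside the ball the principal coefficient is the identity. [folklore] -/
theorem a_eq_of_le (k : Fin N) {y : EuclideanSpace ℝ ι} (hy : 𝒟.R ≤ ‖y‖) (j : W × (ι → W))
    (i i' : ι) : 𝒟.a k (y, j) i i' = if i = i' then 1 else 0 := by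
  rw [a, 𝒟.b_eq_zero k y j hy]
  simp

omit [CompleteSpace W] in
/-- The localisation weights have compact support. [folklore] -/
theorem hasCompactSupport_α (k : Fin N) : HasCompactSupport (𝒟.α k) :=
  HasCompactSupport.of_support_subset_isCompact (isCompact_closedBall 0 𝒟.R)
    ((subset_tsupport _).trans ((𝒟.tsupport_α k).trans ball_subset_closedBall))

/-! ### Reconstruction in a chart and its first-order jet -/

variable {s : ℕ}

/-- **Chart-`k` reconstruction** `ĝ_k[U] = Σ_j m_{kj} · (rep_j U) ∘ τ_{kj}`. [cite: TaylorPDEIII2011, Ch. 15, §7] -/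
def ghat (k : Fin N) (U : Hs W N s ι) : EuclideanSpace ℝ ι → W :=
  fun y => ∑ j, transfer (𝒟.T k j).m (𝒟.T k j).τ (Hs.rep j U) y

/-- **Formal first derivatives of the reconstruction**:
`∂ᵢ ĝ_k = Σ_j [(∂ᵢ m_{kj}) · rep_j ∘ τ + m_{kj} · Σ_l (∂ᵢ τ_{kj})_l · (∂_l rep_j) ∘ τ]`, written
through the evaluation functionals. [folklore] -/
def dghat (k : Fin N) (U : Hs W N s ι) (i : ι) : EuclideanSpace ℝ ι → W :=
  fun y => ∑ j, ((fderiv ℝ (𝒟.T k j).m y (bv i)) • Hs.ev j [] ((𝒟.T k j).τ y) U +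
    (𝒟.T k j).m y • ∑ l, ((fderiv ℝ (𝒟.T k j).τ y (bv i)) l) • Hs.ev j [l] ((𝒟.T k j).τ y) U)

/-- **The first-order jet of the reconstruction** `j¹ĝ_k = (ĝ_k, (∂ᵢ ĝ_k)ᵢ)`. [folklore] -/
def jet1 (k : Fin N) (U : Hs W N s ι) : EuclideanSpace ℝ ι → W × (ι → W) :=
  fun y => (𝒟.ghat k U y, fun i => 𝒟.dghat k U i y)

/-- `ghat` is linear in `U`: as a pointwise continuous linear map. [folklore] -/
theorem ghat_apply_eq (k : Fin N) (U : Hs W N s ι) (y : EuclideanSpace ℝ ι) :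
    𝒟.ghat k U y = ∑ j, (𝒟.T k j).m y • Hs.ev j [] ((𝒟.T k j).τ y) U := rfl

/-- On smooth jets the reconstruction is the classical transfer sum (`dim ≤ s`). [folklore] -/
theorem ghat_jetH (k : Fin N) (hs : Fintype.card ι ≤ s) (u : smoothCS W N ι) :
    𝒟.ghat k (jetH s u) = fun y => ∑ j, transfer (𝒟.T k j).m (𝒟.T k j).τ (u.1 j) y := by
  funext y
  simp only [ghat, rep_jetH hs]

omit [CompleteSpace W] in
/-- The classical reconstruction of a smooth tuple is smooth. [folklore] -/
theorem contDiff_sum_transfer (k : Fin N) (u : smoothCS W N ι) :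
    ContDiff ℝ ∞ fun y => ∑ j, transfer (𝒟.T k j).m (𝒟.T k j).τ (u.1 j) y :=
  ContDiff.sum fun j _ => (𝒟.T k j).contDiff_transfer (u.2 j).1

/-- **On smooth jets `dghat` is the derivative of `ghat`** (`dim + 1 ≤ s`). [folklore] -/
theorem dghat_jetH (k : Fin N) (hs : Fintype.card ι + 1 ≤ s) (u : smoothCS W N ι) (i : ι) :
    𝒟.dghat k (jetH s u) i = cwd [i] (𝒟.ghat k (jetH s u)) := by
  have hs0 : Fintype.card ι ≤ s := by omega
  rw [𝒟.ghat_jetH k hs0, cwd_singleton]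
  funext y
  have hterm : ∀ j, Differentiable ℝ (transfer (𝒟.T k j).m (𝒟.T k j).τ (u.1 j)) := fun j =>
    ((𝒟.T k j).contDiff_transfer (u.2 j).1).differentiable (by simp)
  rw [show (fun y => ∑ j, transfer (𝒟.T k j).m (𝒟.T k j).τ (u.1 j) y) =
      ∑ j, transfer (𝒟.T k j).m (𝒟.T k j).τ (u.1 j) from by funext y; simp,
    fderiv_sum fun j _ => (hterm j y)]
  simp only [FunLike.coe_sum, Finset.sum_apply, dghat]
  refine Finset.sum_congr rfl fun j _ => ?_
  -- one transfer term: the chain rule of `Transfer.lean` with the empty word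
  have h := congrFun ((𝒟.T k j).cwd_transfer (u.2 j).1 [i]) y
  rw [cwd_singleton] at h
  change _ = (fun x => fderiv ℝ (transfer (𝒟.T k j).m (𝒟.T k j).τ (u.1 j)) x (bv i)) y
  rw [h]
  simp only [TransferData.tterms, List.flatMap_cons, List.flatMap_nil, List.append_nil,
    (𝒟.T k j).sum_map_tstep, cwd_nil]
  congr 1
  · rw [ev_jetH (by simpa using hs0)]
    rfl
  · rw [Finset.smul_sum]
    refine Finset.sum_congr rfl fun l _ => ?_
    rw [ev_jetH (by simp; omega), smul_smul]

/-! ### Continuity of the reconstruction and of its jet -/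

omit [DecidableEq ι] [CompleteSpace W] in
/-- A smooth compactly supported cut-off with support inside `Ω` times a function continuous on
`Ω` is continuous. [folklore] -/
theorem continuous_smul_of_continuousOn {c : EuclideanSpace ℝ ι → ℝ} {Ω : Set (EuclideanSpace ℝ ι)}
    (hΩ : IsOpen Ω) (hc : ContDiff ℝ ∞ c) (hcΩ : tsupport c ⊆ Ω) {g : EuclideanSpace ℝ ι → W}
    (hg : ContinuousOn g Ω) : Continuous fun x => c x • g x := by
  have h := contDiff_cutoff_smul (r := 0) hΩ (hc.of_le (by norm_cast)) hcΩ
    (contDiffOn_zero.2 hg)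
  exact contDiff_zero.1 h.1

/-- **Continuity of the reconstruction** (`dim ≤ s`). [folklore] -/
theorem continuous_ghat (k : Fin N) (hs : Fintype.card ι ≤ s) (U : Hs W N s ι) :
    Continuous (𝒟.ghat k U) := by
  refine continuous_finsetSum _ fun j _ => ?_
  refine continuous_smul_of_continuousOn (𝒟.T k j).isOpen_Ω (𝒟.T k j).contDiff_m
    (𝒟.T k j).tsupport_m_subset ?_
  exact (continuous_evFun (v := []) (by simpa using hs) U).comp_continuousOn
    (𝒟.T k j).contDiffOn_τ.continuousOn

/-- **Continuity of the formal first derivatives of the reconstruction** (`dim + 1 ≤ s`).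
[folklore] -/
theorem continuous_dghat (k : Fin N) (hs : Fintype.card ι + 1 ≤ s) (U : Hs W N s ι) (i : ι) :
    Continuous (𝒟.dghat k U i) := by
  refine continuous_finsetSum _ fun j _ => Continuous.add ?_ ?_
  · -- `(∂ᵢ m) · rep ∘ τ`
    have hdm : ContDiff ℝ ∞ fun y => fderiv ℝ (𝒟.T k j).m y (bv i) :=
      ((𝒟.T k j).contDiff_m.fderiv_right (m := ∞) (by norm_cast)).clm_apply contDiff_const
    refine continuous_smul_of_continuousOn (𝒟.T k j).isOpen_Ω hdm
      ((tsupport_fderiv_apply_subset ℝ (bv i)).trans (𝒟.T k j).tsupport_m_subset) ?_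
    exact (continuous_evFun (v := []) (by simp; omega) U).comp_continuousOn
      (𝒟.T k j).contDiffOn_τ.continuousOn
  · -- `m · Σ_l (∂ᵢ τ)_l · (∂_l rep) ∘ τ`
    refine continuous_smul_of_continuousOn (𝒟.T k j).isOpen_Ω (𝒟.T k j).contDiff_m
      (𝒟.T k j).tsupport_m_subset ?_
    refine continuousOn_finsetSum _ fun l _ => ContinuousOn.smul ?_ ?_
    · have h1 : ContinuousOn (fun y => fderiv ℝ (𝒟.T k j).τ y (bv i)) (𝒟.T k j).Ω :=
        ((𝒟.T k j).contDiffOn_τ.continuousOn_fderiv_of_isOpen (𝒟.T k j).isOpen_Ω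
          (by norm_cast)).clm_apply continuousOn_const
      exact (EuclideanSpace.proj (𝕜 := ℝ) l).continuous.comp_continuousOn h1
    · exact (continuous_evFun (v := [l]) (by simp; omega) U).comp_continuousOn
        (𝒟.T k j).contDiffOn_τ.continuousOn

/-- Continuity of the first-order jet (`dim + 1 ≤ s`). [folklore] -/
theorem continuous_jet1 (k : Fin N) (hs : Fintype.card ι + 1 ≤ s) (U : Hs W N s ι) :
    Continuous (𝒟.jet1 k U) :=
  (𝒟.continuous_ghat k (by omega) U).prodMk (continuous_pi fun i => 𝒟.continuous_dghat k hs U i)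

/-! ### The compactly supported part of the localised operator -/

/-- **The lower-order correction** `ℓ_k = -Σ a^{ii'}(∂ᵢα ∂_{i'}ĝ + ∂_{i'}α ∂ᵢĝ + ∂_{ii'}α ĝ) + α f`.
[cite: TaylorPDEIII2011, Ch. 15, §7] -/
def ell (k : Fin N) (U : Hs W N s ι) : EuclideanSpace ℝ ι → W := fun y =>
  -(∑ i, ∑ i', 𝒟.a k (y, 𝒟.jet1 k U y) i i' •
      ((fderiv ℝ (𝒟.α k) y (bv i)) • 𝒟.dghat k U i' y + (fderiv ℝ (𝒟.α k) y (bv i')) • 𝒟.dghat k U i y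
        + (cwd [i, i'] (𝒟.α k) y) • 𝒟.ghat k U y)) +
    (𝒟.α k y) • 𝒟.f k (y, 𝒟.jet1 k U y)

/-- **The compactly supported part of the diagonal localised operator**:
`Fop k U = Σ b^{ii'}(y, j¹ĝ_k) ∂_{ii'} U_k + ℓ_k`, so that `𝒜̃_k(U) = Δ U_k + Fop k U`.
[cite: TaylorPDEIII2011, Ch. 15, §7] -/
def Fop (k : Fin N) (U : Hs W N s ι) : EuclideanSpace ℝ ι → W := fun y =>
  (∑ i, ∑ i', 𝒟.b k (y, 𝒟.jet1 k U y) i i' • Hs.ev k [i, i'] y U) + 𝒟.ell k U y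

/-- Outside the ball, `ℓ_k` vanishes. [folklore] -/
theorem ell_eq_zero (k : Fin N) (U : Hs W N s ι) {y : EuclideanSpace ℝ ι} (hy : 𝒟.R ≤ ‖y‖) :
    𝒟.ell k U y = 0 := by
  have hyα : y ∉ tsupport (𝒟.α k) := fun h => by
    have := 𝒟.tsupport_α k h
    rw [mem_ball, dist_zero_right] at this
    linarith
  have h0 : 𝒟.α k y = 0 := image_eq_zero_of_notMem_tsupport hyα
  have h1 : ∀ i, fderiv ℝ (𝒟.α k) y (bv i) = 0 := fun i => by
    have : y ∉ tsupport (fun y => fderiv ℝ (𝒟.α k) y (bv i)) := fun h =>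
      hyα (tsupport_fderiv_apply_subset ℝ (bv i) h)
    exact image_eq_zero_of_notMem_tsupport (f := fun y => fderiv ℝ (𝒟.α k) y (bv i)) this
  have h2 : ∀ i i', cwd [i, i'] (𝒟.α k) y = 0 := fun i i' => by
    have : y ∉ tsupport (cwd [i, i'] (𝒟.α k)) := fun h => hyα (tsupport_cwd_subset _ _ h)
    exact image_eq_zero_of_notMem_tsupport this
  simp only [ell, h0, h1, h2, zero_smul, add_zero, smul_zero, Finset.sum_const_zero, neg_zero]

/-- **`Fop k U` vanishes outside the closed ball of radius `R`.** [folklore] -/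
theorem Fop_eq_zero (k : Fin N) (U : Hs W N s ι) {y : EuclideanSpace ℝ ι} (hy : 𝒟.R ≤ ‖y‖) :
    𝒟.Fop k U y = 0 := by
  simp only [Fop, 𝒟.b_eq_zero k y _ hy, 𝒟.ell_eq_zero k U hy]
  simp

/-- `Fop k U` has topological support in the closed ball of radius `R`. [folklore] -/
theorem tsupport_Fop_subset (k : Fin N) (U : Hs W N s ι) :
    tsupport (𝒟.Fop k U) ⊆ closedBall (0 : EuclideanSpace ℝ ι) 𝒟.R := by
  refine closure_minimal (fun y hy => ?_) isClosed_closedBall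
  rw [mem_support] at hy
  rw [mem_closedBall, dist_zero_right]
  by_contra h
  exact hy (𝒟.Fop_eq_zero k U (le_of_lt (not_le.1 h)))

/-- `Fop k U` has compact support. [folklore] -/
theorem hasCompactSupport_Fop (k : Fin N) (U : Hs W N s ι) : HasCompactSupport (𝒟.Fop k U) :=
  HasCompactSupport.of_support_subset_isCompact (isCompact_closedBall 0 𝒟.R)
    ((subset_tsupport _).trans (𝒟.tsupport_Fop_subset k U))

/-- **Continuity of `ℓ_k`** (`dim + 1 ≤ s`). [folklore] -/
theorem continuous_ell (k : Fin N) (hs : Fintype.card ι + 1 ≤ s) (U : Hs W N s ι) :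
    Continuous (𝒟.ell k U) := by
  have hjet := 𝒟.continuous_jet1 k hs U
  have hg := 𝒟.continuous_ghat k (by omega) U
  have hdg := fun i => 𝒟.continuous_dghat k hs U i
  have ha : ∀ i i', Continuous fun y => 𝒟.a k (y, 𝒟.jet1 k U y) i i' := fun i i' => by
    have hb : Continuous fun y => 𝒟.b k (y, 𝒟.jet1 k U y) i i' := by
      have h1 : Continuous fun y => 𝒟.b k (y, 𝒟.jet1 k U y) :=
        (𝒟.contDiff_b k).continuous.comp (continuous_id.prodMk hjet)
      exact (continuous_apply i').comp ((continuous_apply i).comp h1)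
    exact continuous_const.add hb
  have hα := (𝒟.contDiff_α k).continuous
  have hdα : ∀ i, Continuous fun y => fderiv ℝ (𝒟.α k) y (bv i) := fun i =>
    ((𝒟.contDiff_α k).continuous_fderiv (by simp)).clm_apply continuous_const
  have hddα : ∀ i i', Continuous (cwd [i, i'] (𝒟.α k)) := fun i i' =>
    continuous_cwd (𝒟.contDiff_α k) _
  have hf : Continuous fun y => 𝒟.f k (y, 𝒟.jet1 k U y) :=
    (𝒟.contDiff_f k).continuous.comp (continuous_id.prodMk hjet)
  unfold ell
  refine Continuous.add (Continuous.neg (continuous_finsetSum _ fun i _ =>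
    continuous_finsetSum _ fun i' _ => (ha i i').smul ?_)) (hα.smul hf)
  exact (((hdα i).smul (hdg i')).add ((hdα i').smul (hdg i))).add ((hddα i i').smul hg)

/-- **Continuity of `Fop k U`** (`dim + 2 ≤ s`). [folklore] -/
theorem continuous_Fop (k : Fin N) (hs : Fintype.card ι + 2 ≤ s) (U : Hs W N s ι) :
    Continuous (𝒟.Fop k U) := by
  have hjet := 𝒟.continuous_jet1 k (by omega) U
  unfold Fop
  refine Continuous.add (continuous_finsetSum _ fun i _ => continuous_finsetSum _ fun i' _ =>
    Continuous.smul ?_ ?_) (𝒟.continuous_ell k (by omega) U)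
  · have h1 : Continuous fun y => 𝒟.b k (y, 𝒟.jet1 k U y) :=
      (𝒟.contDiff_b k).continuous.comp (continuous_id.prodMk hjet)
    exact (continuous_apply i').comp ((continuous_apply i).comp h1)
  · exact continuous_evFun (v := [i, i']) (by simp; omega) U

end ChartData

end Literature.Analysis.PDE

end
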